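import Literature.NumberTheory.EllipticCurves.PAdicOneVariableNormCoherentUnitMomentsTwo
import Literature.NumberTheory.EllipticCurves.PAdicOneVariableMahlerMasses
import Literature.NumberTheory.EllipticCurves.PAdicOneVariableMomentDensity
import Literature.NumberTheory.EllipticCurves.PAdicOneVariableUnitsSocket
import Literature.NumberTheory.EllipticCurves.PAdicDistributionAdditivity
import HarnessLib

/-!
# The pulled-back unit-ball measure DETERMINES the series: `comap ((x⁻¹ D_H)|_{ℤ_p^×}) ψ = comap ((x⁻¹ D_{H'})|_{ℤ_p^×}) ψ`
# forces `H = H'` for unit-supported `D_H`, `D_{H'}` — the injectivity half of de Shalit's I.3.4 Corollary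
# on the measure side (`β ↦ μ_β` is injective up to the kernel of `β ↦ (δβ)~`)

Topic `NumberTheory/EllipticCurves`; namespace `Literature.NumberTheory.EllipticCurves`.

De Shalit, *Iwasawa theory of elliptic curves with complex multiplication* (1987), I.3.1 (p. 15–16): "the
map `μ ↦ P_μ` is an isomorphism" (a measure on `ℤ_p` is determined by its Amice transform and conversely);
I.3.3 (7)–(9) (p. 17–18): `μ̃_β = μ_β|_{ℤ_p^×}` for a measure ALREADY supported on `ℤ_p^×`, pulled back to
`G` along `κ`; I.3.4 Corollary (p. 18): "The map `i` is an injective homomorphism".  The homomorphism half is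
`PAdicOneVariableNormCoherentUnitFamilyTwo.lean`; THIS file is the measure-side injectivity: each of the four
constructions `H ↦ D_H` (`invAmice₁`), `D ↦ x⁻¹·D` (`density … unitInv`), `(·)|_{ℤ_p^×}` (`restrictUnits`) and
`comap` along cell maps hitting every unit class loses nothing on unit-supported data.

* §1 (`D_H = D_{H'}` levelwise ⟹ `H = H'` is the tree's `eq_of_invAmice₁_μ_eq`, `PAdicOneVariableInverseTransform.lean`)
  `eq_zero_of_invAmice₁_μ_eq_zero` — `D_H = 0` levelwise ⟹ `H = 0`;
* §2 `isUnit_toZModPow_succ_iff`; `density_unitInv_μ_succ_of_not_isUnit` (`x⁻¹·D` vanishes on non-unit classes,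
  automatically); `μ_succ_eq_integral_density_unitInv` (`D(b) = ∫ 𝟙_b·x d(x⁻¹D)` on unit classes `b`);
  `μ_eq_of_density_unitInv_μ_eq` (unit-supported `D`, `D'` with `x⁻¹D = x⁻¹D'` are equal);
* §3 `μ_zero_eq_of_μ_one_eq` (level `0` from level `1`), `density_unitInv_μ_eq_of_restrictUnits_μ_eq`;
* §4 `μ_eq_of_comap_μ_eq` (cells in the image of `ψ`), and at `p = 2` along the Lubin–Tate tower
  `exists_ltCell_eq_of_isUnit` (EVERY unit class of `ℤ/2^{n+1}` is a `ψ_n(σU_n)`: `(ℤ/2)ˣ = 1`);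
* §5 ★★ `eq_of_comap_restrictUnits_density_invAmice₁_μ_eq_two` — the title statement at `p = 2`;
* §6 ★★ `map_subst_tildeSer_logDeriv_eq_of_comap_μ_eq` — for norm-coherent units `β, β'` of the Lubin–Tate
  tower of `f' = π'X + X²`: **`D_β = D_{β'}` levelwise ⟹ `θ((δβ)~ ∘ ϑ) = θ((δβ')~ ∘ ϑ)`** (support (7′) from
  `invAmice₁_μ_eq_zero_normCoherentUnits`).

Everything is proved; no named facts, no definitions, no instances (section-local instance attributes as in the
siblings), no `sorry`.

## References

* [deShalit1987] E. de Shalit, *Iwasawa theory of elliptic curves with complex multiplication* (1987),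
  I.3.1 (1)–(3) (p. 15–16), I.3.3 (7)–(9) (p. 17–18), I.3.4 Corollary (p. 18).
* [MazurTateTeitelbaum1986Invent] B. Mazur, J. Tate, J. Teitelbaum, Invent. Math. 84 (1986), §I.11.
-/

noncomputable section

open Filter
open scoped Topology Classical

namespace Literature.NumberTheory.EllipticCurves

/-! ### §1. `D_H` determines `H` -/

section InvAmice

variable {p : ℕ} [Fact p.Prime]
variable {𝕜 : Type*} [NormedField 𝕜] [NormedAlgebra ℚ_[p] 𝕜] [IsUltrametricDist 𝕜] [CompleteSpace 𝕜]

/-- `D_H = 0` levelwise ⟹ `H = 0`. [cite: deShalit1987, I.3.1 (1)–(3) (p. 16)] -/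
theorem eq_zero_of_invAmice₁_μ_eq_zero {P : PowerSeries 𝕜} {C : ℝ} (hC : ∀ k, ‖PowerSeries.coeff k P‖ ≤ C)
    (h : ∀ n a, (invAmice₁ p P hC).μ n a = 0) : P = 0 := by
  rw [← BoundedDistribution.amice_invAmice₁ (p := p) hC]
  ext j
  rw [BoundedDistribution.coeff_amice, BoundedDistribution.amiceCoeff_def, map_zero]
  exact BoundedDistribution.integral_eq_zero_of_μ_eq_zero _ h _

end InvAmice

/-! ### §2. `x⁻¹ · D` determines `D` on the unit classes -/

section Density

variable {p : ℕ} [Fact p.Prime]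
variable {𝕜 : Type*} [NormedField 𝕜] [NormedAlgebra ℚ_[p] 𝕜]

/-- A class modulo `p^{n+1}` is a unit iff any (every) lift to `ℤ_p` is a unit.
[cite: deShalit1987, I.3.3 (7′) (p. 17–18)] -/
theorem isUnit_toZModPow_succ_iff (n : ℕ) (x : ℤ_[p]) : IsUnit (PadicInt.toZModPow (n + 1) x) ↔ IsUnit x := by
  refine ⟨fun h ↦ ?_, fun h ↦ h.map _⟩
  have h1 : IsUnit (ZMod.castHom (pow_dvd_pow p (Nat.le_add_left 1 n)) (ZMod (p ^ 1))
      (PadicInt.toZModPow (n + 1) x)) := h.map _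
  rw [ZMod.castHom_apply, PadicInt.cast_toZModPow 1 (n + 1) (Nat.le_add_left 1 n)] at h1
  exact (isUnit_toZModPow_one_iff x).mp h1

variable [IsUltrametricDist 𝕜] [CompleteSpace 𝕜]

/-- **`x⁻¹ · D` vanishes on the non-unit classes** of every level `≥ 1`, for ANY `D` (the density `x⁻¹`,
extended by `0` off `ℤ_p^×`, kills them). [cite: deShalit1987, I.3.3 (7′), I.3.5 (11) (p. 17–18)] -/
theorem density_unitInv_μ_succ_of_not_isUnit (D : BoundedDistribution (ProfiniteTower.padicInt p) 𝕜) (n : ℕ)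
    (b : ZMod (p ^ (n + 1))) (hb : ¬ IsUnit b) :
    (D.density (ProfiniteTower.padicInt_isUniform p) (unitInv 𝕜) uniformContinuous_unitInv norm_unitInv_le).μ
      (n + 1) b = 0 := by
  rw [BoundedDistribution.density_μ]
  have h0 : BoundedDistribution.cellFun (T := ProfiniteTower.padicInt p) (n + 1) b (unitInv 𝕜) = fun _ ↦ 0 := by
    funext x
    rw [BoundedDistribution.cellFun_apply, ProfiniteTower.padicInt_proj]
    split_ifs with hx
    · have hxu : ¬ IsUnit x := fun hu ↦ hb (hx ▸ (isUnit_toZModPow_succ_iff n x).mpr hu)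
      rw [unitInv_of_not_isUnit hxu, mul_zero]
    · rw [zero_mul]
  rw [h0]
  have h1 : (fun _ : ℤ_[p] ↦ (0 : 𝕜)) = fun x ↦ (fun _ : ZMod (p ^ 0) ↦ (0 : 𝕜)) ((ProfiniteTower.padicInt p).proj 0 x) :=
    rfl
  rw [h1, D.integral_eq_sum_of_factorsThrough (m := 0) (fun _ ↦ (0 : 𝕜)) (fun _ ↦ rfl)]
  simp

/-- **`D(b) = ∫ 𝟙_b · x d(x⁻¹ D)` on every unit class `b`** (on `b` every point is a unit, so
`𝟙_b · x · x⁻¹ = 𝟙_b`). [cite: deShalit1987, I.3.5 (11) (p. 18)] -/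
theorem μ_succ_eq_integral_density_unitInv (D : BoundedDistribution (ProfiniteTower.padicInt p) 𝕜) (n : ℕ)
    (b : ZMod (p ^ (n + 1))) (hb : IsUnit b) :
    D.μ (n + 1) b =
      (D.density (ProfiniteTower.padicInt_isUniform p) (unitInv 𝕜) uniformContinuous_unitInv norm_unitInv_le).integral
        (BoundedDistribution.cellFun (T := ProfiniteTower.padicInt p) (n + 1) b (padicIntCast 𝕜)) := by
  rw [BoundedDistribution.integral_density _ _ _ _ _
    (BoundedDistribution.uniformContinuous_cellFun (T := ProfiniteTower.padicInt p)
      (ProfiniteTower.padicInt_isUniform p) (n + 1) b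
      (f := ⇑(padicIntCast 𝕜)) uniformContinuous_padicIntCast' norm_padicIntCast_le_one)
    (BoundedDistribution.norm_cellFun_le (T := ProfiniteTower.padicInt p) (n + 1) b (f := ⇑(padicIntCast 𝕜))
      norm_padicIntCast_le_one),
    BoundedDistribution.μ_eq_integral_cellIndicator]
  refine congrArg D.integral (funext fun x ↦ ?_)
  rw [BoundedDistribution.cellFun_apply]
  split_ifs with hx
  · have hx' : PadicInt.toZModPow (n + 1) x = b := hx
    have hxu : IsUnit x := (isUnit_toZModPow_succ_iff n x).mp (by rw [hx']; exact hb)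
    have hne : padicIntCast 𝕜 x ≠ 0 := (hxu.map (padicIntCast 𝕜)).ne_zero
    change padicIntCast 𝕜 (if PadicInt.toZModPow (n + 1) x = b then 1 else 0) = _
    rw [if_pos hx', map_one, one_mul, unitInv_eq_inv hxu, mul_inv_cancel₀ hne]
  · have hx' : ¬ PadicInt.toZModPow (n + 1) x = b := hx
    change padicIntCast 𝕜 (if PadicInt.toZModPow (n + 1) x = b then 1 else 0) = _
    rw [if_neg hx', map_zero, zero_mul, zero_mul]

/-- **Unit-supported distributions with the same `x⁻¹`-density agree** on every class of level `≥ 1`.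
[cite: deShalit1987, I.3.3 (7′), I.3.5 (11) (p. 17–18)] -/
theorem μ_succ_eq_of_density_unitInv_μ_eq (D D' : BoundedDistribution (ProfiniteTower.padicInt p) 𝕜)
    (hsupp : ∀ (n : ℕ) (b : ZMod (p ^ (n + 1))), ¬ IsUnit b → D.μ (n + 1) b = 0)
    (hsupp' : ∀ (n : ℕ) (b : ZMod (p ^ (n + 1))), ¬ IsUnit b → D'.μ (n + 1) b = 0)
    (h : ∀ n a, (D.density (ProfiniteTower.padicInt_isUniform p) (unitInv 𝕜) uniformContinuous_unitInv
        norm_unitInv_le).μ n a =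
      (D'.density (ProfiniteTower.padicInt_isUniform p) (unitInv 𝕜) uniformContinuous_unitInv norm_unitInv_le).μ n a)
    (n : ℕ) (b : ZMod (p ^ (n + 1))) : D.μ (n + 1) b = D'.μ (n + 1) b := by
  by_cases hb : IsUnit b
  · rw [μ_succ_eq_integral_density_unitInv D n b hb, μ_succ_eq_integral_density_unitInv D' n b hb]
    exact BoundedDistribution.integral_congr_of_μ_eq _ _ h _
  · rw [hsupp n b hb, hsupp' n b hb]

/-! ### §3. Level `0` from level `1`; `(·)|_{ℤ_p^×}` determines `x⁻¹ · D` -/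

omit [NormedAlgebra ℚ_[p] 𝕜] [IsUltrametricDist 𝕜] [CompleteSpace 𝕜] in
/-- The level-`0` datum (total mass) is the sum of the level-`1` data.
[cite: MazurTateTeitelbaum1986Invent, §I.11] -/
theorem μ_zero_eq_of_μ_one_eq (D D' : BoundedDistribution (ProfiniteTower.padicInt p) 𝕜)
    (h : ∀ b : ZMod (p ^ 1), D.μ 1 b = D'.μ 1 b) (a : (ProfiniteTower.padicInt p).Cell 0) :
    D.μ 0 a = D'.μ 0 a := by
  rw [← D.sum_fiber 0 a, ← D'.sum_fiber 0 a]
  exact Finset.sum_congr rfl fun b _ ↦ h b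

omit [NormedAlgebra ℚ_[p] 𝕜] [IsUltrametricDist 𝕜] [CompleteSpace 𝕜] in
/-- Levelwise equality from equality on all levels `≥ 1`. [cite: MazurTateTeitelbaum1986Invent, §I.11] -/
theorem μ_eq_of_μ_succ_eq (D D' : BoundedDistribution (ProfiniteTower.padicInt p) 𝕜)
    (h : ∀ (n : ℕ) (b : ZMod (p ^ (n + 1))), D.μ (n + 1) b = D'.μ (n + 1) b) (n : ℕ)
    (a : (ProfiniteTower.padicInt p).Cell n) : D.μ n a = D'.μ n a := by
  cases n with
  | zero => exact μ_zero_eq_of_μ_one_eq D D' (h 0) a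
  | succ n => exact h n a

/-- **`(x⁻¹D)|_{ℤ_p^×} = (x⁻¹D')|_{ℤ_p^×}` ⟹ `x⁻¹D = x⁻¹D'` levelwise** (off the units both vanish, §2).
[cite: deShalit1987, I.3.3 (7′) (p. 17–18)] -/
theorem density_unitInv_μ_eq_of_restrictUnits_μ_eq (D D' : BoundedDistribution (ProfiniteTower.padicInt p) 𝕜)
    (h : ∀ n b, (restrictUnits (D.density (ProfiniteTower.padicInt_isUniform p) (unitInv 𝕜)
        uniformContinuous_unitInv norm_unitInv_le)).μ n b =
      (restrictUnits (D'.density (ProfiniteTower.padicInt_isUniform p) (unitInv 𝕜)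
        uniformContinuous_unitInv norm_unitInv_le)).μ n b) (n : ℕ) (a : ZMod (p ^ n)) :
    (D.density (ProfiniteTower.padicInt_isUniform p) (unitInv 𝕜) uniformContinuous_unitInv norm_unitInv_le).μ n a =
      (D'.density (ProfiniteTower.padicInt_isUniform p) (unitInv 𝕜) uniformContinuous_unitInv norm_unitInv_le).μ
        n a := by
  refine μ_eq_of_μ_succ_eq _ _ (fun n b ↦ ?_) n a
  by_cases hb : IsUnit b
  · have hn := h n b
    rwa [restrictUnits_μ, restrictUnits_μ, if_pos hb, if_pos hb] at hn
  · rw [density_unitInv_μ_succ_of_not_isUnit D n b hb, density_unitInv_μ_succ_of_not_isUnit D' n b hb]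

end Density

/-! ### §4. `comap` determines the measure on the image cells; at `p = 2` every unit class is an image -/

namespace GroupDistribution

variable {G : Type*} [Group G] {𝒰 : SubgroupTower G} [∀ n, (𝒰.U n).Normal] {X : Type*}
  [PseudoMetricSpace X] {T : ProfiniteTower X} {𝕜 : Type*} [NormedField 𝕜]

/-- Equal pull-backs read equal data on every image cell `ψ_n(a)`, `a ⊆ U_0`.
[cite: deShalit1987, I.3.3 (9) (p. 18)] -/
theorem μ_eq_of_comap_μ_eq (ν ν' : BoundedDistribution T 𝕜) (ψ : (n : ℕ) → G ⧸ 𝒰.U n → T.Cell n) (hψ) (hinj)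
    (hsurj) (h : ∀ n a, (comap ν ψ hψ hinj hsurj).μ n a = (comap ν' ψ hψ hinj hsurj).μ n a) (n : ℕ)
    (a : G ⧸ 𝒰.U n) (ha : 𝒰.transLE (Nat.zero_le n) a = 1) : ν.μ n (ψ n a) = ν'.μ n (ψ n a) := by
  have hn := h n a
  rwa [comap_μ_of_transLE_eq_one _ _ _ _ _ n a ha, comap_μ_of_transLE_eq_one _ _ _ _ _ n a ha] at hn

end GroupDistribution

section LubinTateTwo

open ValuativeRel IsLocalRing Field
open Literature.NumberTheory.GaloisRepresentations Literature.NumberTheory.GaloisRepresentations.IsNonarchimedeanLocalField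
  Literature.NumberTheory.GaloisRepresentations.LubinTate

variable {F : Type} [Field F] [ValuativeRel F] [TopologicalSpace F] [IsNonarchimedeanLocalField F]

attribute [local instance] ltTower_U_normal

variable {π : 𝒪[F]} (hπ : (valuation F).IsUniformizer (π : F)) (e : 𝒪[F] ≃+* ℤ_[2])
  (ψ : (n : ℕ) → absoluteGaloisGroup F ⧸ (ltTower hπ).U n → ZMod (2 ^ (n + 1)))
  (hψ : ∀ (n : ℕ) (σ : absoluteGaloisGroup F), σ ∈ (ltTower hπ).U 0 →
    ψ n ((ltTower hπ).proj n σ) = PadicInt.toZModPow (n + 1)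
      (((Units.map (e : 𝒪[F] →+* ℤ_[2]).toMonoidHom).comp (lubinTateCharHom hπ) σ : ℤ_[2]ˣ) : ℤ_[2]))

include hψ in
/-- **At `p = 2` every unit class of `ℤ/2^{n+1}` is a cell image `ψ_n(σU_n)` with `σ ∈ U_0`** — the
Lubin–Tate character is onto `ℤ₂ˣ` modulo `2^{n+1}` (`exists_toZModPow_ltCharacter_eq`) and `(ℤ/2)ˣ = 1`,
so the congruence `≡ 1 mod 2` is automatic. [cite: deShalit1987, I.3.3 (9) (p. 18)]
[cite: CasselsFrohlichANT1967, Ch. VI §3.6 Prop. 6 (b)] -/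
theorem exists_ltCell_eq_of_isUnit (n : ℕ) (c : ZMod (2 ^ (n + 1))) (hc : IsUnit c) :
    ∃ a : absoluteGaloisGroup F ⧸ (ltTower hπ).U n, (ltTower hπ).transLE (Nat.zero_le n) a = 1 ∧ ψ n a = c := by
  haveI : NeZero (2 ^ (n + 1)) := ⟨pow_ne_zero _ two_ne_zero⟩
  -- a unit of `ℤ₂` lifting `c`
  have hx : PadicInt.toZModPow (n + 1) ((c.val : ℕ) : ℤ_[2]) = c := by
    rw [map_natCast, ZMod.natCast_zmod_val]
  have hxu : IsUnit ((c.val : ℕ) : ℤ_[2]) := (isUnit_toZModPow_succ_iff n _).mp (hx.symm ▸ hc)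
  have hu1 : PadicInt.toZModPow 1 ((hxu.unit : ℤ_[2]ˣ) : ℤ_[2]) = 1 := by
    have key : ∀ z : ZMod (2 ^ 1), IsUnit z → z = 1 := by decide
    exact key _ ((Units.isUnit _).map _)
  obtain ⟨σ, hσ0, hσ⟩ := exists_toZModPow_ltCharacter_eq hπ e n hxu.unit hu1
  refine ⟨(ltTower hπ).proj n σ, ?_, ?_⟩
  · rw [SubgroupTower.transLE_proj, SubgroupTower.proj_apply, QuotientGroup.eq_one_iff]
    exact hσ0
  · rw [hψ n σ hσ0, hσ, IsUnit.unit_spec, hx]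

end LubinTateTwo

/-! ### §5. The title statement at `p = 2` -/

section Assembly

open ValuativeRel IsLocalRing Field
open Literature.NumberTheory.GaloisRepresentations Literature.NumberTheory.GaloisRepresentations.IsNonarchimedeanLocalField
  Literature.NumberTheory.GaloisRepresentations.LubinTate

variable {F : Type} [Field F] [ValuativeRel F] [TopologicalSpace F] [IsNonarchimedeanLocalField F]

attribute [local instance] ltTower_U_normal

variable {π : 𝒪[F]} (hπ : (valuation F).IsUniformizer (π : F)) (e : 𝒪[F] ≃+* ℤ_[2])
  (ψ : (n : ℕ) → absoluteGaloisGroup F ⧸ (ltTower hπ).U n → ZMod (2 ^ (n + 1)))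
  (hψ : ∀ (n : ℕ) (σ : absoluteGaloisGroup F), σ ∈ (ltTower hπ).U 0 →
    ψ n ((ltTower hπ).proj n σ) = PadicInt.toZModPow (n + 1)
      (((Units.map (e : 𝒪[F] →+* ℤ_[2]).toMonoidHom).comp (lubinTateCharHom hπ) σ : ℤ_[2]ˣ) : ℤ_[2]))
variable {𝕜 : Type*} [NormedField 𝕜] [NormedAlgebra ℚ_[2] 𝕜] [IsUltrametricDist 𝕜] [CompleteSpace 𝕜]

/-- ★★ **The pulled-back unit-ball measure determines the series** (`p = 2`, Lubin–Tate tower with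
`κ = e ∘ χ_π`): if `D_H` and `D_{H'}` are supported on `ℤ₂ˣ` (de Shalit's (7′)) and
`comap ((x⁻¹D_H)|_{ℤ₂ˣ}) ψ = comap ((x⁻¹D_{H'})|_{ℤ₂ˣ}) ψ` levelwise, then `H = H'`.
[cite: deShalit1987, I.3.1 (1)–(3) (p. 16), I.3.3 (7′)–(9) (p. 17–18), I.3.4 Corollary (p. 18)] -/
theorem eq_of_comap_restrictUnits_density_invAmice₁_μ_eq_two {H H' : PowerSeries 𝕜} {C C' : ℝ}
    (hC : ∀ k, ‖PowerSeries.coeff k H‖ ≤ C) (hC' : ∀ k, ‖PowerSeries.coeff k H'‖ ≤ C')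
    (hsupp : ∀ (N : ℕ) (b : ZMod (2 ^ (N + 1))), ¬ IsUnit b → (invAmice₁ 2 H hC).μ (N + 1) b = 0)
    (hsupp' : ∀ (N : ℕ) (b : ZMod (2 ^ (N + 1))), ¬ IsUnit b → (invAmice₁ 2 H' hC').μ (N + 1) b = 0)
    (h : ∀ (n : ℕ) (a : absoluteGaloisGroup F ⧸ (ltTower hπ).U n),
      (GroupDistribution.comap (restrictUnits ((invAmice₁ 2 H hC).density (ProfiniteTower.padicInt_isUniform 2)
          (unitInv 𝕜) uniformContinuous_unitInv norm_unitInv_le)) ψ ((ltTower hπ).cellMap_trans _ ψ hψ)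
          ((ltTower hπ).cellMap_injective _ (mem_ltTower_iff hπ e) ψ hψ)
          ((ltTower hπ).cellMap_fiberSurj _ (mem_ltTower_iff hπ e) (exists_toZModPow_ltCharacter_eq hπ e) ψ hψ)).μ
          n a =
        (GroupDistribution.comap (restrictUnits ((invAmice₁ 2 H' hC').density (ProfiniteTower.padicInt_isUniform 2)
          (unitInv 𝕜) uniformContinuous_unitInv norm_unitInv_le)) ψ ((ltTower hπ).cellMap_trans _ ψ hψ)
          ((ltTower hπ).cellMap_injective _ (mem_ltTower_iff hπ e) ψ hψ)
          ((ltTower hπ).cellMap_fiberSurj _ (mem_ltTower_iff hπ e) (exists_toZModPow_ltCharacter_eq hπ e) ψ hψ)).μ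
          n a) :
    H = H' := by
  -- (1) the restrictions to `ℤ₂ˣ` of the `x⁻¹`-densities agree levelwise
  have h1 : ∀ (n : ℕ) (b : ZMod (2 ^ (n + 1))),
      (restrictUnits ((invAmice₁ 2 H hC).density (ProfiniteTower.padicInt_isUniform 2) (unitInv 𝕜)
          uniformContinuous_unitInv norm_unitInv_le)).μ n b =
        (restrictUnits ((invAmice₁ 2 H' hC').density (ProfiniteTower.padicInt_isUniform 2) (unitInv 𝕜)
          uniformContinuous_unitInv norm_unitInv_le)).μ n b := by
    intro n b
    by_cases hb : IsUnit b
    · obtain ⟨a, ha, hab⟩ := exists_ltCell_eq_of_isUnit hπ e ψ hψ n b hb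
      rw [← hab]
      exact GroupDistribution.μ_eq_of_comap_μ_eq (T := (ProfiniteTower.padicInt 2).succ) _ _ ψ _ _ _ h n a ha
    · rw [restrictUnits_μ, restrictUnits_μ, if_neg hb, if_neg hb]
  -- (2) hence the densities, (3) hence `D_H = D_{H'}` on all levels, (4) hence `H = H'`
  have h2 := density_unitInv_μ_eq_of_restrictUnits_μ_eq _ _ h1
  have h3 : ∀ n a, (invAmice₁ 2 H hC).μ n a = (invAmice₁ 2 H' hC').μ n a :=
    μ_eq_of_μ_succ_eq _ _ (μ_succ_eq_of_density_unitInv_μ_eq _ _ hsupp hsupp' h2)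
  exact eq_of_invAmice₁_μ_eq hC hC' h3

end Assembly

/-! ### §6. Norm-coherent units of the Lubin–Tate tower of `f' = π'X + X²`: `D_β = D_{β'}` forces `H_β = H_{β'}` -/

section NormCoherentUnitsTwo

open MvPowerSeries ValuativeRel IsLocalRing Field
open Literature.NumberTheory.GaloisRepresentations Literature.NumberTheory.GaloisRepresentations.IsNonarchimedeanLocalField
  Literature.NumberTheory.GaloisRepresentations.LubinTate Literature.NumberTheory.PAdicHodge

variable {F : Type} [Field F] [ValuativeRel F] [TopologicalSpace F] [IsNonarchimedeanLocalField F]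

attribute [local instance] ltNormUniformSpace ltNormIsUniformAddGroup rk1 nF nE fintypeResidueField
attribute [local instance] ltTower_U_normal

variable (hq : residueFieldCard F = 2) (h2 : (valuation F).IsUniformizer (((2 : ℕ) : 𝒪[F]) : F))
  {σ₀ : absoluteGaloisGroup F} (hσ₀ : IsAbsArithFrob σ₀) (u : 𝒪[F]ˣ)
  {ε : (maxUnramifiedCompletion F)ˣ}
  (hε : maxUnramifiedCompletion.galAut F σ₀ (ε : maxUnramifiedCompletion F) =
    algebraMap 𝒪[F] (maxUnramifiedCompletion F) (u : 𝒪[F]) * (ε : maxUnramifiedCompletion F))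
variable (θ : CompletedAlgClosure F →+* ℂ_[2]) (hθc : Continuous θ)
  (hθ1 : ∀ z : CBall F, ‖θ (z : CompletedAlgClosure F)‖ ≤ 1)
  (hθζ : ∀ ζ' : ℂ_[2], (∃ n : ℕ, ζ' ^ 2 ^ n = 1) →
    ∃ ζ : CompletedAlgClosure F, (∃ n : ℕ, ζ ^ 2 ^ n = 1) ∧ θ ζ = ζ')
variable (e : 𝒪[F] ≃+* ℤ_[2])
  (ψ : (n : ℕ) → absoluteGaloisGroup F ⧸ (ltTower (isUniformizer_unit_mul h2 u)).U n → ZMod (2 ^ (n + 1)))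
  (hψ : ∀ (n : ℕ) (σ : absoluteGaloisGroup F), σ ∈ (ltTower (isUniformizer_unit_mul h2 u)).U 0 →
    ψ n ((ltTower (isUniformizer_unit_mul h2 u)).proj n σ) = PadicInt.toZModPow (n + 1)
      (((Units.map (e : 𝒪[F] →+* ℤ_[2]).toMonoidHom).comp (lubinTateCharHom (isUniformizer_unit_mul h2 u)) σ :
        ℤ_[2]ˣ) : ℤ_[2]))

include hq hθc hθζ in
/-- ★★ **For norm-coherent units `β, β'`: `D_β = D_{β'}` levelwise ⟹ `H_β = H_{β'}`** (`H_β = θ((δβ)~ ∘ ϑ)`;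
the measures are unit-supported by (7′), `invAmice₁_μ_eq_zero_normCoherentUnits`) — the measure-side
injectivity of de Shalit's `i` on the Lubin–Tate tower of `f' = π'X + X²`.
[cite: deShalit1987, I.3.3 (7′)–(9) (p. 17–18), I.3.4 Corollary (p. 18)] -/
theorem map_subst_tildeSer_logDeriv_eq_of_comap_μ_eq (n₀ : ℕ)
    (β β' : NormCoherentUnits (isUniformizer_unit_mul h2 u))
    (h : ∀ (n : ℕ) (a : absoluteGaloisGroup F ⧸ (ltTower (isUniformizer_unit_mul h2 u)).U n),
      (GroupDistribution.comap (restrictUnits ((invAmice₁ 2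
        ((PowerSeries.subst ((compSeriesC h2 hσ₀ u hε).map (algebraMap (UnrCoeff F) (CBall F)))
          ((tildeSer ((u : 𝒪[F]) * ((2 : ℕ) : 𝒪[F])) (LTCoeff.of F (u : 𝒪[F])) β.logDeriv).map
            ((algebraMap (UnrCoeff F) (CBall F)).comp
              ((intToUnrCoeff F).comp (LTCoeff.of F).symm.toRingHom)))).map (θ.comp (CBall F).subtype))
        (norm_coeff_map_le_one θ hθ1
          (PowerSeries.subst ((compSeriesC h2 hσ₀ u hε).map (algebraMap (UnrCoeff F) (CBall F)))
            ((tildeSer ((u : 𝒪[F]) * ((2 : ℕ) : 𝒪[F])) (LTCoeff.of F (u : 𝒪[F])) β.logDeriv).map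
              ((algebraMap (UnrCoeff F) (CBall F)).comp
                ((intToUnrCoeff F).comp (LTCoeff.of F).symm.toRingHom)))))).density
        (ProfiniteTower.padicInt_isUniform 2) (unitInv ℂ_[2]) uniformContinuous_unitInv norm_unitInv_le))
        ψ ((ltTower (isUniformizer_unit_mul h2 u)).cellMap_trans _ ψ hψ)
        ((ltTower (isUniformizer_unit_mul h2 u)).cellMap_injective _
          (mem_ltTower_iff (isUniformizer_unit_mul h2 u) e) ψ hψ)
        ((ltTower (isUniformizer_unit_mul h2 u)).cellMap_fiberSurj _
          (mem_ltTower_iff (isUniformizer_unit_mul h2 u) e)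
          (exists_toZModPow_ltCharacter_eq (isUniformizer_unit_mul h2 u) e) ψ hψ)).μ n a =
      (GroupDistribution.comap (restrictUnits ((invAmice₁ 2
        ((PowerSeries.subst ((compSeriesC h2 hσ₀ u hε).map (algebraMap (UnrCoeff F) (CBall F)))
          ((tildeSer ((u : 𝒪[F]) * ((2 : ℕ) : 𝒪[F])) (LTCoeff.of F (u : 𝒪[F])) β'.logDeriv).map
            ((algebraMap (UnrCoeff F) (CBall F)).comp
              ((intToUnrCoeff F).comp (LTCoeff.of F).symm.toRingHom)))).map (θ.comp (CBall F).subtype))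
        (norm_coeff_map_le_one θ hθ1
          (PowerSeries.subst ((compSeriesC h2 hσ₀ u hε).map (algebraMap (UnrCoeff F) (CBall F)))
            ((tildeSer ((u : 𝒪[F]) * ((2 : ℕ) : 𝒪[F])) (LTCoeff.of F (u : 𝒪[F])) β'.logDeriv).map
              ((algebraMap (UnrCoeff F) (CBall F)).comp
                ((intToUnrCoeff F).comp (LTCoeff.of F).symm.toRingHom)))))).density
        (ProfiniteTower.padicInt_isUniform 2) (unitInv ℂ_[2]) uniformContinuous_unitInv norm_unitInv_le))
        ψ ((ltTower (isUniformizer_unit_mul h2 u)).cellMap_trans _ ψ hψ)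
        ((ltTower (isUniformizer_unit_mul h2 u)).cellMap_injective _
          (mem_ltTower_iff (isUniformizer_unit_mul h2 u) e) ψ hψ)
        ((ltTower (isUniformizer_unit_mul h2 u)).cellMap_fiberSurj _
          (mem_ltTower_iff (isUniformizer_unit_mul h2 u) e)
          (exists_toZModPow_ltCharacter_eq (isUniformizer_unit_mul h2 u) e) ψ hψ)).μ n a) :
    (PowerSeries.subst ((compSeriesC h2 hσ₀ u hε).map (algebraMap (UnrCoeff F) (CBall F)))
        ((tildeSer ((u : 𝒪[F]) * ((2 : ℕ) : 𝒪[F])) (LTCoeff.of F (u : 𝒪[F])) β.logDeriv).map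
          ((algebraMap (UnrCoeff F) (CBall F)).comp
            ((intToUnrCoeff F).comp (LTCoeff.of F).symm.toRingHom)))).map (θ.comp (CBall F).subtype) =
      (PowerSeries.subst ((compSeriesC h2 hσ₀ u hε).map (algebraMap (UnrCoeff F) (CBall F)))
        ((tildeSer ((u : 𝒪[F]) * ((2 : ℕ) : 𝒪[F])) (LTCoeff.of F (u : 𝒪[F])) β'.logDeriv).map
          ((algebraMap (UnrCoeff F) (CBall F)).comp
            ((intToUnrCoeff F).comp (LTCoeff.of F).symm.toRingHom)))).map (θ.comp (CBall F).subtype) :=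
  eq_of_comap_restrictUnits_density_invAmice₁_μ_eq_two (isUniformizer_unit_mul h2 u) e ψ hψ _ _
    (fun N b hb ↦ invAmice₁_μ_eq_zero_normCoherentUnits hq h2 hσ₀ u hε θ hθc hθ1 hθζ n₀ β N b hb)
    (fun N b hb ↦ invAmice₁_μ_eq_zero_normCoherentUnits hq h2 hσ₀ u hε θ hθc hθ1 hθζ n₀ β' N b hb) h

end NormCoherentUnitsTwo

end Literature.NumberTheory.EllipticCurves

end
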